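import Literature.NumberTheory.Automorphic.TateLocalFactors
import Literature.RepresentationTheory.TwistedCoinvariants
import HarnessLib

/-!
# Crux `H413`, programme P2, N3 road (S3) — THE LOCALLY-CONSTANT COBOUNDARY LEMMA (Kudla's anisotropy ∕ partition trick, model-free):
# a Schwartz–Bruhat function vanishing on the exceptional set is a sum of coboundaries `u·φ − φ` of locally constant multipliers

Cell hodgecm-mathlib (D-0151), FLOOR 0, crux item H413 = stmt-HodgeConjecture-24833, programme P2; the #76 U′-N pay-down's last print residue
N3 (★ letter `GelbartRogawski1991.thetaType_nonsplit_jacquetModule`, INVENTORY III-42), road note `F0/P2/B-p18/g28/N3-ROAD.v1.B-p18g28.md`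
(K1 lead B-p18 (g28)) §2 step (S3) «KEY (Kudla's anisotropy argument): functions vanishing near `y* = 0` are `Z(N(ℓ))`-coboundaries by the
locally-constant partition trick» — isolated here as PURE TOPOLOGY∕LINEAR ALGEBRA over the tree's ★ `SchwartzBruhat X` (locally constant, compactly
supported `X → ℂ`), for ANY topological space `X`, ANY exceptional set `X₀ ⊆ X` and ANY family `𝒰` of locally constant multipliers moving
every point off `X₀` (second hand F0P2-p05 (g0), capital for the N3 line).  THEOREMS ONLY (no `def`, no instance, no notation, no named fact,
no `sorry`); kernel lane `--supports stmt-HodgeConjecture-24833 --as helper`.  HC_CM is proved only modulo the 2 remaining named inputs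
(hLiu418, h413) until rung 0 closes; nothing printed is asserted here.

THE LEMMA.  `𝒰 ⊆ (X → ℂ)` locally constant, `X₀ ⊆ X`, `hsep : ∀ x ∉ X₀, ∃ u ∈ 𝒰, u x ≠ 1`.  Then every `f ∈ 𝒮(X)` with `f|_{X₀} = 0` lies in
`span_ℂ {u·φ − φ : u ∈ 𝒰, φ ∈ 𝒮(X)}` (`SchwartzBruhat.mem_span_mul_sub_of_forall_eq_zero`).  No hypothesis on `X`: the support `K` of a locally
constant compactly supported `f` is COMPACT AND OPEN, it avoids `X₀`, and it is covered by finitely many clopen pieces `W ⊆ K` on each of which `f`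
and one chosen `u ∈ 𝒰` are constant, `u ≡ c ≠ 1`; disjointify along the finite cover and use `1_W · a = (c − 1)⁻¹ • (u · (1_W · a) − 1_W · a)`.
In the N3 setting (`X = ` the Schrödinger model's base, `X₀ = {y* = 0}`, `𝒰 = {y ↦ ψ_v(z · Q(y*)) : z ∈ F_v}` with `Q` the ANISOTROPIC norm form at a
non-split place — `Q(y*) ≠ 0` off `X₀`, and a non-trivial `ψ_v` takes a value `≠ 1` at some multiple of it) this is exactly «`f(0) = 0 ⇒ f` is a
`Z(N(ℓ))`-coboundary»; in MVW's stable-range pattern it is the free-orbit half.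

* §1 Schwartz–Bruhat bookkeeping: indicators of compact clopen sets, the support of `f ∈ 𝒮(X)` is clopen and compact.
* §2 one piece: `1_W · a ∈ span` when some `u ∈ 𝒰` is constant `≠ 1` on the compact clopen `W` (`indicator_const_mem_span`).
* §3 finitely many pieces (induction on the finite cover, peeling `W_a ∖ ⋃_{i∈s} W_i`): `(⋃_{i∈s} W_i).indicator f ∈ span`.
* §4 HEAD `mem_span_mul_sub_of_forall_eq_zero` (+ the point form `…_of_apply_eq_zero`), and §5 the COINVARIANT form: for a representation `ρ` of any
  group `Z` on `↥(SchwartzBruhat X)` acting by such multipliers, `f|_{X₀} = 0 ⇒ f ∈ TwistedCoinv.ker ρ 1` (`TwistedCoinv.mk ρ 1 f = 0`) — the shape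
  (S2)∕(S4) of the road consume (★ `TwistedCoinv.ker = span {ρ z φ − φ}`).

## References
* [Kudla1986] S. Kudla, *On the local theta-correspondence*, Invent. Math. 83 (1986) 229–255: proof of Thm. 2.8 (Jacquet modules of the Weil
  representation; the anisotropic-kernel step).
* [MoeglinVignerasWaldspurger1987] LNM 1291 (1987), Chap. 3 §IV.5 (filtration de Kudla), Chap. 2 II.1.
* [BernsteinZelevinsky1976] I. N. Bernstein, A. V. Zelevinsky, Russian Math. Surveys 31 (1976), §1 (locally constant compactly supported
  functions), §2.30–2.33 (Jacquet functor, coinvariants).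
* [GelbartRogawski1991] Invent. Math. 105 (1991), §3.2 (3.2.3) p. 457 (the centre of `N` acts by `ψ(t N_{E/F}(w))`).
-/

set_option autoImplicit false
set_option linter.dupNamespace false -- the mandated namespace repeats the single-problem summit's segment

noncomputable section

open Set Topology
open Literature.NumberTheory.Automorphic Literature.RepresentationTheory

namespace Summit.HodgeConjecture.HodgeConjecture.Cruxes.H413.F0P2oLocallyConstantCoboundary

variable {X : Type*} [TopologicalSpace X]

/-! ## §1 Schwartz–Bruhat bookkeeping -/

/-- The indicator of a CLOPEN set times a constant is locally constant. [cite: BernsteinZelevinsky1976, §1.1] -/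
theorem isLocallyConstant_indicator_const {W : Set X} (hW : IsClopen W) (a : ℂ) :
    IsLocallyConstant (W.indicator fun _ => a) := by
  refine (IsLocallyConstant.iff_exists_open _).2 fun x => ?_
  by_cases hx : x ∈ W
  · exact ⟨W, hW.isOpen, hx, fun y hy => by rw [indicator_of_mem hy, indicator_of_mem hx]⟩
  · exact ⟨Wᶜ, hW.compl.isOpen, hx, fun y hy => by rw [indicator_of_notMem hy, indicator_of_notMem hx]⟩

/-- The indicator of a COMPACT CLOPEN set times a constant is a Schwartz–Bruhat function. [cite: BernsteinZelevinsky1976, §1.1] -/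
theorem indicator_const_mem_schwartzBruhat {W : Set X} (hW : IsClopen W) (hWc : IsCompact W) (a : ℂ) :
    (W.indicator fun _ => a) ∈ SchwartzBruhat X :=
  ⟨isLocallyConstant_indicator_const hW a,
    HasCompactSupport.intro' hWc hW.isClosed fun _ hx => indicator_of_notMem hx _⟩

/-- The support of a locally constant function is clopen. [cite: BernsteinZelevinsky1976, §1.1] -/
theorem isClopen_support {f : X → ℂ} (hf : IsLocallyConstant f) : IsClopen (Function.support f) := by
  have : Function.support f = (f ⁻¹' {0})ᶜ := by
    ext x; simp [Function.mem_support]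
  rw [this]
  exact (hf.isClopen_fiber 0).compl

/-- The support of a Schwartz–Bruhat function is compact (it is closed, so it is its own topological support). [cite: BernsteinZelevinsky1976, §1.1] -/
theorem isCompact_support {f : X → ℂ} (hf : f ∈ SchwartzBruhat X) : IsCompact (Function.support f) := by
  have h := hf.2
  rw [HasCompactSupport, tsupport, (isClopen_support hf.1).isClosed.closure_eq] at h
  exact h

/-! ## §2 One piece: a compact clopen set on which a multiplier is constant `≠ 1` -/

/-- **One piece.**  If `u ∈ 𝒰` is constant `= c ≠ 1` on a compact clopen `W`, then `1_W · a ∈ span {u·φ − φ}`: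
`1_W · a = (c − 1)⁻¹ • (u · (1_W · a) − 1_W · a)`. [cite: Kudla1986, proof of Thm. 2.8] -/
theorem indicator_const_mem_span (𝒰 : Set (X → ℂ)) {u : X → ℂ} (hu : u ∈ 𝒰) {W : Set X} (hW : IsClopen W) (hWc : IsCompact W)
    {c : ℂ} (hc : c ≠ 1) (huW : ∀ x ∈ W, u x = c) (a : ℂ) :
    (W.indicator fun _ => a) ∈ Submodule.span ℂ {g : X → ℂ | ∃ u ∈ 𝒰, ∃ φ ∈ SchwartzBruhat X, g = u * φ - φ} := by
  have hmem : u * (W.indicator fun _ => a) - (W.indicator fun _ => a) ∈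
      Submodule.span ℂ {g : X → ℂ | ∃ u ∈ 𝒰, ∃ φ ∈ SchwartzBruhat X, g = u * φ - φ} :=
    Submodule.subset_span ⟨u, hu, _, indicator_const_mem_schwartzBruhat hW hWc a, rfl⟩
  have heq : (W.indicator fun _ => a) = (c - 1)⁻¹ • (u * (W.indicator fun _ => a) - (W.indicator fun _ => a)) := by
    have hc1 : c - 1 ≠ 0 := sub_ne_zero.2 hc
    funext x
    by_cases hx : x ∈ W
    · simp only [Pi.smul_apply, Pi.sub_apply, Pi.mul_apply, indicator_of_mem hx, huW x hx, smul_eq_mul]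
      rw [show c * a - a = (c - 1) * a by ring, inv_mul_cancel_left₀ hc1]
    · simp only [Pi.smul_apply, Pi.sub_apply, Pi.mul_apply, indicator_of_notMem hx, smul_eq_mul, mul_zero, sub_zero]
  rw [heq]
  exact Submodule.smul_mem _ _ hmem

/-! ## §3 Finitely many pieces: peel `W_a ∖ ⋃_{i ∈ s} W_i` -/

/-- **Finitely many pieces.**  For a finite family of compact clopen sets `W i` on each of which `f` is constant and some `u i ∈ 𝒰` is constant
`≠ 1`, the restriction `(⋃_{i∈s} W i).indicator f` lies in `span {u·φ − φ}` — induction on `s`, peeling the clopen compact difference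
`W a ∖ ⋃_{i∈s} W i`. [cite: Kudla1986, proof of Thm. 2.8] [cite: BernsteinZelevinsky1976, §1.1] -/
theorem indicator_biUnion_mem_span {ι : Type*} (𝒰 : Set (X → ℂ)) (f : X → ℂ) (W : ι → Set X) (u : ι → X → ℂ) (c a : ι → ℂ)
    (s : Finset ι) (hW : ∀ i ∈ s, IsClopen (W i)) (hWc : ∀ i ∈ s, IsCompact (W i)) (hu : ∀ i ∈ s, u i ∈ 𝒰)
    (hc : ∀ i ∈ s, c i ≠ 1) (huW : ∀ i ∈ s, ∀ x ∈ W i, u i x = c i) (hfW : ∀ i ∈ s, ∀ x ∈ W i, f x = a i) :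
    (⋃ i ∈ s, W i).indicator f ∈ Submodule.span ℂ {g : X → ℂ | ∃ u ∈ 𝒰, ∃ φ ∈ SchwartzBruhat X, g = u * φ - φ} := by
  classical
  induction s using Finset.induction_on with
  | empty =>
    have h0 : (⋃ i ∈ (∅ : Finset ι), W i).indicator f = 0 := by
      funext x; simp
    rw [h0]
    exact Submodule.zero_mem _
  | insert j s hj ih =>
    have hW' : ∀ i ∈ s, IsClopen (W i) := fun i hi => hW i (Finset.mem_insert_of_mem hi)
    have hWc' : ∀ i ∈ s, IsCompact (W i) := fun i hi => hWc i (Finset.mem_insert_of_mem hi)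
    have hu' : ∀ i ∈ s, u i ∈ 𝒰 := fun i hi => hu i (Finset.mem_insert_of_mem hi)
    have hc' : ∀ i ∈ s, c i ≠ 1 := fun i hi => hc i (Finset.mem_insert_of_mem hi)
    have huW' : ∀ i ∈ s, ∀ x ∈ W i, u i x = c i := fun i hi => huW i (Finset.mem_insert_of_mem hi)
    have hfW' : ∀ i ∈ s, ∀ x ∈ W i, f x = a i := fun i hi => hfW i (Finset.mem_insert_of_mem hi)
    -- the union over `s` is clopen
    have hU : IsClopen (⋃ i ∈ s, W i) := isClopen_biUnion_finset hW'
    -- split `⋃_{insert j s} = (W j \ U) ∪ U` disjointly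
    have hsplit : (⋃ i ∈ insert j s, W i) = (W j \ ⋃ i ∈ s, W i) ∪ ⋃ i ∈ s, W i := by
      rw [Finset.set_biUnion_insert, sdiff_union_self]
    rw [hsplit, indicator_union_of_disjoint disjoint_sdiff_left]
    refine Submodule.add_mem _ ?_ (ih hW' hWc' hu' hc' huW' hfW')
    -- the peeled piece: `f` is constant `= a j` there and `u j ≡ c j ≠ 1`
    have hpiece : (W j \ ⋃ i ∈ s, W i).indicator f = (W j \ ⋃ i ∈ s, W i).indicator fun _ => a j :=
      indicator_congr fun x hx => hfW j (Finset.mem_insert_self j s) x hx.1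
    rw [hpiece]
    exact indicator_const_mem_span 𝒰 (hu j (Finset.mem_insert_self j s)) ((hW j (Finset.mem_insert_self j s)).diff hU)
      ((hWc j (Finset.mem_insert_self j s)).of_isClosed_subset ((hW j (Finset.mem_insert_self j s)).diff hU).isClosed sdiff_subset)
      (hc j (Finset.mem_insert_self j s)) (fun x hx => huW j (Finset.mem_insert_self j s) x hx.1) (a j)

/-! ## §4 HEAD: the locally-constant coboundary lemma -/

/-- **THE LOCALLY-CONSTANT COBOUNDARY LEMMA (Kudla's anisotropy ∕ partition trick).**  `X` any topological space, `𝒰` a family of LOCALLY CONSTANT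
functions `X → ℂ`, `X₀ ⊆ X` an exceptional set such that every point OFF `X₀` is moved by some multiplier (`∀ x ∉ X₀, ∃ u ∈ 𝒰, u x ≠ 1`).  Then every
Schwartz–Bruhat function `f` (locally constant, compact support) VANISHING ON `X₀` is a finite sum of coboundaries:
`f ∈ span_ℂ {u·φ − φ : u ∈ 𝒰, φ ∈ 𝒮(X)}`.  (The support of `f` is compact open and avoids `X₀`; cover it by finitely many compact clopen pieces on
which `f` and a chosen multiplier are constant; §3.)  For `𝒰 = {ψ(z·Q(·))}` with `Q` anisotropic and `X₀ = Q⁻¹(0)` this is «`r_{N(ℓ)}` kills exactly the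
functions vanishing near the isotropic kernel» of [Kudla1986, Thm. 2.8]'s proof. [cite: Kudla1986, proof of Thm. 2.8]
[cite: MoeglinVignerasWaldspurger1987, Chap. 3 §IV.5] [cite: BernsteinZelevinsky1976, §1.1] -/
theorem mem_span_mul_sub_of_forall_eq_zero (𝒰 : Set (X → ℂ)) (h𝒰 : ∀ u ∈ 𝒰, IsLocallyConstant u) (X₀ : Set X)
    (hsep : ∀ x, x ∉ X₀ → ∃ u ∈ 𝒰, u x ≠ 1) {f : X → ℂ} (hf : f ∈ SchwartzBruhat X) (hf₀ : ∀ x ∈ X₀, f x = 0) :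
    f ∈ Submodule.span ℂ {g : X → ℂ | ∃ u ∈ 𝒰, ∃ φ ∈ SchwartzBruhat X, g = u * φ - φ} := by
  classical
  -- the support `K`: compact, open, off `X₀`
  set K := Function.support f with hK
  have hKc : IsCompact K := isCompact_support hf
  have hKo : IsClopen K := isClopen_support hf.1
  have hKX₀ : ∀ x ∈ K, x ∉ X₀ := fun x hx hx₀ => hx (hf₀ x hx₀)
  -- choose a multiplier at every point of `K`
  choose u hu𝒰 hux using fun x : K => hsep x (hKX₀ x x.2)
  -- the pieces: `V x = K ∩ {f = f x} ∩ {u_x = u_x x}`, open neighbourhoods of `x ∈ K`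
  let V : K → Set X := fun x => K ∩ (f ⁻¹' {f x} ∩ u x ⁻¹' {u x x})
  have hVcl : ∀ x : K, IsClopen (V x) := fun x =>
    hKo.inter ((hf.1.isClopen_fiber _).inter ((h𝒰 _ (hu𝒰 x)).isClopen_fiber _))
  have hVo : ∀ x : K, IsOpen (V x) := fun x => (hVcl x).isOpen
  have hVK : ∀ x : K, V x ⊆ K := fun x => inter_subset_left
  have hVc : ∀ x : K, IsCompact (V x) := fun x => hKc.of_isClosed_subset (hVcl x).isClosed (hVK x)
  -- finite subcover of `K`
  obtain ⟨t, ht⟩ := hKc.elim_finite_subcover (fun x : K => V x) hVo fun x hx => mem_iUnion.2 ⟨⟨x, hx⟩, hx, rfl, rfl⟩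
  -- `f` = its restriction to the union of the chosen pieces
  have hKU : K = ⋃ x ∈ t, V x := by
    refine Subset.antisymm (fun y hy => ?_) (iUnion₂_subset fun x _ => hVK x)
    simpa only [mem_iUnion, exists_prop] using ht hy
  have hfU : f = (⋃ x ∈ t, V x).indicator f := by
    rw [← hKU, eq_comm, indicator_eq_self]
  rw [hfU]
  exact indicator_biUnion_mem_span 𝒰 f V (fun x => u x) (fun x => u x x) (fun x => f x) t (fun x _ => hVcl x) (fun x _ => hVc x)
    (fun x _ => hu𝒰 x) (fun x _ => hux x) (fun x _ y hy => hy.2.2) (fun x _ y hy => hy.2.1)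

/-- **Point form**: if every point other than `x₀` is moved by some locally constant `u ∈ 𝒰`, then every `f ∈ 𝒮(X)` with `f x₀ = 0` lies in
`span {u·φ − φ}` («`f(0) = 0 ⇒ f` is a coboundary»). [cite: Kudla1986, proof of Thm. 2.8] [cite: BernsteinZelevinsky1976, §1.1] -/
theorem mem_span_mul_sub_of_apply_eq_zero (𝒰 : Set (X → ℂ)) (h𝒰 : ∀ u ∈ 𝒰, IsLocallyConstant u) (x₀ : X)
    (hsep : ∀ x, x ≠ x₀ → ∃ u ∈ 𝒰, u x ≠ 1) {f : X → ℂ} (hf : f ∈ SchwartzBruhat X) (hf₀ : f x₀ = 0) :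
    f ∈ Submodule.span ℂ {g : X → ℂ | ∃ u ∈ 𝒰, ∃ φ ∈ SchwartzBruhat X, g = u * φ - φ} :=
  mem_span_mul_sub_of_forall_eq_zero 𝒰 h𝒰 {x₀} (fun x hx => hsep x hx) hf fun x hx => by rw [hx]; exact hf₀

/-! ## §5 The coinvariant form: multiplier representations on `↥(SchwartzBruhat X)` -/

/-- **COINVARIANT FORM** (the shape (S2)∕(S4) of the N3 road consume).  Let a group `Z` act on `↥(SchwartzBruhat X)` by MULTIPLIERS:
`(ρ z φ)(x) = u_z(x) · φ(x)` with every `u_z` locally constant, and suppose every point off `X₀` is moved by some `u_z`.  Then every `φ ∈ 𝒮(X)`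
vanishing on `X₀` lies in the relation submodule of the (trivial-character) coinvariants: `φ ∈ TwistedCoinv.ker ρ 1` — i.e. `φ` dies in
`r_Z(𝒮(X)) = TwistedCoinv.Coinv ρ 1`. [cite: Kudla1986, proof of Thm. 2.8] [cite: BernsteinZelevinsky1976, §2.30–2.33] -/
theorem mem_twistedCoinv_ker_of_forall_eq_zero {Z : Type*} [Group Z] (ρ : Representation ℂ Z ↥(SchwartzBruhat X)) (u : Z → X → ℂ)
    (hu : ∀ z, IsLocallyConstant (u z)) (hρ : ∀ (z : Z) (φ : ↥(SchwartzBruhat X)), ((ρ z φ : ↥(SchwartzBruhat X)) : X → ℂ) = u z * φ)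
    (X₀ : Set X) (hsep : ∀ x, x ∉ X₀ → ∃ z, u z x ≠ 1) (φ : ↥(SchwartzBruhat X)) (hφ₀ : ∀ x ∈ X₀, (φ : X → ℂ) x = 0) :
    φ ∈ TwistedCoinv.ker ρ 1 := by
  -- the ambient span of §4 for `𝒰 = range u`
  have hmem := mem_span_mul_sub_of_forall_eq_zero (Set.range u) (by rintro _ ⟨z, rfl⟩; exact hu z) X₀
    (fun x hx => by obtain ⟨z, hz⟩ := hsep x hx; exact ⟨u z, ⟨z, rfl⟩, hz⟩) φ.2 hφ₀
  -- it is contained in the image of the relation submodule under the inclusion `↥(SchwartzBruhat X) ↪ (X → ℂ)`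
  have hle : Submodule.span ℂ {g : X → ℂ | ∃ u' ∈ Set.range u, ∃ ψ ∈ SchwartzBruhat X, g = u' * ψ - ψ} ≤
      (TwistedCoinv.ker ρ 1).map (SchwartzBruhat X).subtype := by
    refine Submodule.span_le.2 ?_
    rintro _ ⟨_, ⟨z, rfl⟩, ψ, hψ, rfl⟩
    refine ⟨ρ z ⟨ψ, hψ⟩ - ⟨ψ, hψ⟩, ?_, ?_⟩
    · have h := TwistedCoinv.sub_mem_ker ρ (1 : Z →* ℂˣ) z ⟨ψ, hψ⟩
      rwa [MonoidHom.one_apply, Units.val_one, one_smul] at h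
    · rw [map_sub, Submodule.subtype_apply, Submodule.subtype_apply, hρ]
  obtain ⟨ψ, hψ, hψφ⟩ := hle hmem
  have : ψ = φ := Subtype.ext hψφ
  rw [← this]
  exact hψ

/-- Hence such a `φ` DIES in the coinvariants: `TwistedCoinv.mk ρ 1 φ = 0`. [cite: Kudla1986, proof of Thm. 2.8] [cite: BernsteinZelevinsky1976, §2.30–2.33] -/
theorem twistedCoinv_mk_eq_zero_of_forall_eq_zero {Z : Type*} [Group Z] (ρ : Representation ℂ Z ↥(SchwartzBruhat X)) (u : Z → X → ℂ)
    (hu : ∀ z, IsLocallyConstant (u z)) (hρ : ∀ (z : Z) (φ : ↥(SchwartzBruhat X)), ((ρ z φ : ↥(SchwartzBruhat X)) : X → ℂ) = u z * φ)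
    (X₀ : Set X) (hsep : ∀ x, x ∉ X₀ → ∃ z, u z x ≠ 1) (φ : ↥(SchwartzBruhat X)) (hφ₀ : ∀ x ∈ X₀, (φ : X → ℂ) x = 0) :
    TwistedCoinv.mk ρ 1 φ = 0 := by
  rw [TwistedCoinv.mk_apply, Submodule.Quotient.mk_eq_zero]
  exact mem_twistedCoinv_ker_of_forall_eq_zero ρ u hu hρ X₀ hsep φ hφ₀

end Summit.HodgeConjecture.HodgeConjecture.Cruxes.H413.F0P2oLocallyConstantCoboundary

end
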